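import Literature.Probability.RandomPlanarGeometry.SAWPulledFreeEnergyZ2
import Literature.Probability.RandomPlanarGeometry.SAWBridgeSpanGF
import Literature.Probability.RandomPlanarGeometry.SAWBridgeRenewalEquation
import Literature.Probability.RandomPlanarGeometry.BDGS2012
import Mathlib.Analysis.SpecificLimits.Normed
import Mathlib.Algebra.Field.GeomSum
import HarnessLib

/-!
# Explicit ballistic gain for pulled self-avoiding bridges, half-space walks and drifted SAWs (every dimension)

Topic `Literature/Probability/RandomPlanarGeometry` (continues `SAWBridgeSpanGF.lean`, `SAWBridgeRenewalEquation.lean`;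
the objects `pulledBridgeZ`, `driftZ` and the walk-sum form `pulledBridgeZ_eq_sum_bridges` are those of
`SAWPulledFreeEnergyZ2.lean`).

Sources (printed status, as held). N. R. Beaton, *J. Phys. A* 48 (2015) 16FT03, Theorem 1 and its
proof, eq. (8): in EVERY dimension `d`, the critical fugacity of pulled SAWs in a half-space is `y_c = 1`;
inside the proof, `B(z,y) ≥ yI(z,1)/(1 - yI(z,1))` gives `z_b(y) < z_c` for `y > 1` — pulled BRIDGES are
strictly super-`μ` for every `y > 1` (qualitative, no rate) [cite: Beaton2015, Theorem 1 and its proof, eq. (8)].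
D. Ioffe, Y. Velenik (2008), §1.4 (1): for the drifted SAW `P_n^h` (every `d`, every drift `h ≠ 0`) the
measures concentrate exponentially on ballistic trajectories — a ballistic PHASE, no free-energy gain printed
[cite: IoffeVelenik2008, §1.4 (1)]. The printed EXPLICIT state: E. J. Janse van Rensburg, S. G. Whittington
(2013), §3.2 "Bounds on λ(y)" (arXiv:1307.6457, Theorem 8 / Corollary 2): `max{log μ_d, log y} ≤ λ(y) ≤ log μ_d + log y` [cite: JansevanRensburgWhittington2013, §3.2, Theorem 8 and Corollary 2] — the
only explicit lower bound in print, `log y`, beats `log μ_d` only for `y > μ_d`.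

Claim of this file: the explicit gain `e^{λ_B(y)} ≥ μ_d + e^{-2/(y-1)}` for EVERY `y > 1` and every `d` is new
(an explicit-gain form of `y_c = 1`); grade: new-combination (Kesten's divergence bound + span generating
functions + supermultiplicativity).

## What is new in this file (not in print)

An EXPLICIT gain, in every dimension `d + 1 ≥ 1`, from the tree's Hammersley–Welsh / Kesten bound alone
(`Zd.sum_count_le_exp`: `Σ_{n≤M} cₙ z^{n+1} ≤ exp(2 B⁺_{M+1}(z))`, `μⁿ ≤ cₙ`, the span generating functions
`Zd.brGF_pow_le` / `Zd.bridgeGFpos_le_of_brGF_le`, bridge concatenation):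

* `pulledBridgeZ_geometric_lower`: for every pull `y > 1` and every `0 < ρ < μ + e^{-2/(y-1)}` there is
  `C > 0` with `C ρᴺ ≤ Z^B_N(y) := Σ_{β ∈ B_N} y^{span β}` for all `N` — i.e.
  `λ_B(y) ≥ log(μ + e^{-2/(y-1)}) > log μ`, strict ballisticity of pulled bridges with an explicit gain;
* `pulledBridgeZ_le_pulledHalfSpaceZ_le_driftZ`: `Z^B_N(e^θ) ≤ Z^H_N(e^θ) ≤ Z_N(θ) := Σ_{ω ∈ SAW_N} e^{θ x₁(ω_N)}`;
* `driftZ_geometric_lower`: the same gain for half-space pulled walks and for the drifted partition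
  function, `θ > 0`.

Chain (lane labels R30.x of «pcv-sawmu», typed and proved by a-idea-1): `exists_truncation_level`
(admissible `z` ⇒ finite truncation level) → `half_log_geom_le_bridgeGFpos`
(`B⁺_{M+1}(z) ≥ ½ log(z Σ_{n≤M}(zμ)ⁿ)`) → `exists_span_lt_brGF` (a span `A` with `V_{M+1}(z;A) > y^{-A}`) →
`Zd.brGF_pow_le` + `pow_mul_brGF_le_sum_pulledBridgeZ` (`Σ_{n ≤ k(M+1)} Z^B_n(y) zⁿ ≥ (y^A V)^k`) →
`exists_one_lt_pulledBridgeZ_mul_pow` (one length `n₁ ≥ 1` with `Z^B_{n₁}(y) z^{n₁} > 1`) →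
`pulledBridgeZ_geometric_of_one` (supermultiplicativity `pulledBridgeZ_mul_le` + positivity ⇒ all `N`) →
`pulledBridgeZ_geometric_of_admissible` → `pulledBridgeZ_geometric_lower` → `driftZ_geometric_lower`.
-/

noncomputable section

open Finset Filter Topology Literature.Probability.LatticeModels
open Literature.Probability.RandomPlanarGeometry.SAW
open scoped BigOperators

namespace Literature.Probability.RandomPlanarGeometry.SAW.Zd

/-- Pulled half-space partition function (M–S half-space walks `ω₁(i) > 0` for `i ≥ 1`; endpoint level
`ω N 0 ≥ 0`), `Z^H_N(y) = Σ_{ω ∈ H_N} y^{x₁(ω_N)}`.  Beaton's `C⁺_N(y)` is this up to the one-step shift.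
[cite: Beaton2015, §2 (pulled half-plane walks)] -/
def pulledHalfSpaceZ (d : ℕ) [NeZero d] (N : ℕ) (y : ℝ) : ℝ :=
  ∑ ω ∈ Zd.halfSpaceWalks d N, y ^ (ω N 0).toNat

/-- The span of a bridge is non-negative (`ω 0 = 0` and `ω₁(0) < ω₁(N)` for `N ≥ 1`).
[cite: MadrasSlade1993, Definition 1.2.4] -/
theorem span_nonneg_of_mem_bridges {d N : ℕ} {ω : ℕ → Site (d + 1)}
    (hω : ω ∈ Zd.bridges (d + 1) N) : 0 ≤ ω N 0 := by
  obtain ⟨hωs, hbr⟩ := Zd.mem_bridges.1 hω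
  obtain ⟨h00, -, -, -⟩ := Zd.mem_saws.1 hωs
  rcases Nat.eq_zero_or_pos N with rfl | hN
  · rw [h00]; exact le_rfl
  · have h := (hbr N hN le_rfl).1
    rw [h00] at h
    exact le_of_lt h

/-- The span of an `N`-step bridge is at most `N`.
[cite: MadrasSlade1993, Definition 1.2.4] -/
theorem span_le_of_mem_bridges {d N : ℕ} {ω : ℕ → Site (d + 1)}
    (hω : ω ∈ Zd.bridges (d + 1) N) : ω N 0 ≤ N := by
  obtain ⟨hωs, -⟩ := Zd.mem_bridges.1 hω
  obtain ⟨h00, -, hadj, -⟩ := Zd.mem_saws.1 hωs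
  exact (le_abs_self _).trans (Zd.abs_apply_le_of_adj h00 hadj N le_rfl 0)

/-- (R30.1) explicit divergence of the truncated bridge generating function strictly INSIDE the
disc: `B⁺_{M+1}(z) ≥ ½ log( z · Σ_{n ≤ M} (zμ)ⁿ )` for `0 < z`, from `Σ_{n≤M} cₙ z^{n+1} ≤ exp(2 B⁺_{M+1}(z))`
(`Zd.sum_count_le_exp`) and `cₙ ≥ μⁿ`.  Limit form: `B(z) - 1 ≥ ½ log(z/(1 - zμ))` for `z < 1/μ`.
[cite: MadrasSlade1993, §3.1, eqs. (3.1.13)–(3.1.14) (quantitative form inside the disc, derived)] -/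
theorem half_log_geom_le_bridgeGFpos (d M : ℕ) {z : ℝ} (hz : 0 < z) :
    Real.log (z * ∑ n ∈ Finset.range (M + 1), (z * Zd.connectiveConstant (d + 1)) ^ n) / 2 ≤
      Zd.bridgeGFpos (d + 1) (M + 1) z := by
  have hμ0 : 0 ≤ Zd.connectiveConstant (d + 1) := (Zd.connectiveConstant_pos (d + 1)).le
  have h1 : z * ∑ n ∈ Finset.range (M + 1), (z * Zd.connectiveConstant (d + 1)) ^ n ≤
      ∑ n ∈ Finset.range (M + 1), (Zd.count (d + 1) n : ℝ) * z ^ (n + 1) := by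
    rw [Finset.mul_sum]
    refine Finset.sum_le_sum fun n _ => ?_
    rw [mul_pow, pow_succ]
    have := Zd.pow_connectiveConstant_le_count (d + 1) n
    have hz' : 0 ≤ z ^ n * z := by positivity
    nlinarith
  have h2 := Zd.sum_count_le_exp (d := d + 1) M hz.le
  have hpos : 0 < z * ∑ n ∈ Finset.range (M + 1), (z * Zd.connectiveConstant (d + 1)) ^ n := by
    apply mul_pos hz
    refine lt_of_lt_of_le zero_lt_one ?_
    have : (1 : ℝ) = (z * Zd.connectiveConstant (d + 1)) ^ 0 := (pow_zero _).symm
    rw [this]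
    exact Finset.single_le_sum (f := fun n => (z * Zd.connectiveConstant (d + 1)) ^ n)
      (fun n _ => pow_nonneg (mul_nonneg hz.le hμ0) n) (Finset.mem_range.2 (Nat.succ_pos M))
  have h3 : Real.log (z * ∑ n ∈ Finset.range (M + 1), (z * Zd.connectiveConstant (d + 1)) ^ n) ≤
      2 * Zd.bridgeGFpos (d + 1) (M + 1) z := by
    rw [Real.log_le_iff_le_exp hpos]
    exact h1.trans h2
  linarith

/-- (R30.2) GOOD SPAN: if `B⁺_M(z) > 1/(e^ε - 1)` then some span `A ∈ [1, M]` carries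
`V_M(z;A) > e^{-εA}` (contrapositive of `Zd.bridgeGFpos_le_of_brGF_le` at `ρ = e^{-ε}`,
`ρ/(1-ρ) = 1/(e^ε - 1)`).
[cite: MadrasSlade1993, §3.1, proof of Corollary 3.1.8 (derived)] -/
theorem exists_span_lt_brGF (d M : ℕ) {z ε : ℝ} (hz : 0 ≤ z) (hε : 0 < ε)
    (h : 1 / (Real.exp ε - 1) < Zd.bridgeGFpos (d + 1) M z) :
    ∃ A : ℕ, 1 ≤ A ∧ A ≤ M ∧ Real.exp (-(ε * A)) < Zd.brGF (d + 1) M z (A : ℤ) := by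
  classical
  by_contra! hcon
  set ρ : ℝ := Real.exp (-ε) with hρ
  have hρ0 : 0 ≤ ρ := (Real.exp_pos _).le
  have hρ1 : ρ < 1 := by
    have h1 : Real.exp (-ε) < Real.exp 0 := Real.exp_lt_exp.2 (by linarith)
    rwa [Real.exp_zero] at h1
  have hρA : ∀ A : ℕ, Real.exp (-(ε * A)) = ρ ^ A := fun A => by
    rw [hρ, ← Real.exp_nat_mul]; ring_nf
  -- no bridge of length `≤ M` has span `> M`
  have hzero : ∀ A : ℕ, M < A → Zd.brGF (d + 1) M z (A : ℤ) = 0 := by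
    intro A hA
    rw [Zd.brGF]
    refine Finset.sum_eq_zero fun n hn => ?_
    have hnM : n ≤ M := Nat.lt_succ_iff.1 (Finset.mem_range.1 hn)
    have hem : Zd.brSpan (d + 1) n (A : ℤ) = ∅ := by
      rw [Finset.eq_empty_iff_forall_notMem]
      intro ω hω
      obtain ⟨hωb, hωA⟩ := Zd.mem_brSpan.1 hω
      have := span_le_of_mem_bridges hωb
      rw [hωA] at this
      exact absurd this (by omega)
    rw [hem, Finset.card_empty, Nat.cast_zero, zero_mul]
  have hall : ∀ A : ℕ, 1 ≤ A → Zd.brGF (d + 1) M z (A : ℤ) ≤ ρ ^ A := by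
    intro A hA1
    rcases le_or_gt A M with hAM | hAM
    · rw [← hρA]; exact hcon A hA1 hAM
    · rw [hzero A hAM]; exact pow_nonneg hρ0 A
  have hB := Zd.bridgeGFpos_le_of_brGF_le (d := d + 1) M hz hρ0 hρ1 hall
  -- `ρ/(1-ρ) = 1/(e^ε - 1)`
  have hid : ρ / (1 - ρ) = 1 / (Real.exp ε - 1) := by
    have hε1 : Real.exp ε - 1 ≠ 0 := by
      have : 1 < Real.exp ε := by rw [← Real.exp_zero]; exact Real.exp_lt_exp.2 hε
      linarith
    have h1ρ : 1 - ρ ≠ 0 := by linarith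
    rw [div_eq_div_iff h1ρ hε1, hρ, mul_sub, ← Real.exp_add, neg_add_cancel, Real.exp_zero]
    ring
  rw [hid] at hB
  linarith

/-- Walk-sum weights multiply under gluing: `y^{span(η ⊕ τ)} = y^{span η} · y^{span τ}`.
[cite: MadrasSlade1993, §1.2, eq. (1.2.15)] -/
theorem pow_span_concatWalk {d k M : ℕ} {η τ : ℕ → Site (d + 1)} (y : ℝ)
    (hη : η ∈ Zd.bridges (d + 1) k) (hτ : τ ∈ Zd.bridges (d + 1) M) :
    y ^ (Zd.concatWalk k η τ (k + M) 0).toNat = y ^ (η k 0).toNat * y ^ (τ M 0).toNat := by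
  have hτ0 : τ 0 = 0 := (Zd.mem_saws.1 (Zd.mem_bridges.1 hτ).1).1
  rw [Zd.concatWalk_apply_add η τ hτ0 M, Pi.add_apply,
    Int.toNat_add (span_nonneg_of_mem_bridges hη) (span_nonneg_of_mem_bridges hτ), pow_add]

/-- (R30.0) supermultiplicativity of the pulled bridge partition function:
`Z^B_M(y) · Z^B_N(y) ≤ Z^B_{M+N}(y)` (glue two bridges; spans add).
[cite: Beaton2015, §2 (supermultiplicativity of pulled bridges); MadrasSlade1993, eq. (1.2.15)] -/
theorem pulledBridgeZ_mul_le (d M N : ℕ) {y : ℝ} (hy : 0 ≤ y) :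
    pulledBridgeZ (d + 1) M y * pulledBridgeZ (d + 1) N y ≤ pulledBridgeZ (d + 1) (M + N) y := by
  classical
  rw [pulledBridgeZ_eq_sum_bridges, pulledBridgeZ_eq_sum_bridges, pulledBridgeZ_eq_sum_bridges,
    Finset.sum_mul_sum, ← Finset.sum_product']
  -- glue the two bridges: injective, lands in `bridges (M+N)`, weights multiply
  have hN : N = M + N - M := (Nat.add_sub_cancel_left M N).symm
  have hinj : Set.InjOn (fun p : (ℕ → Site (d + 1)) × (ℕ → Site (d + 1)) => Zd.concatWalk M p.1 p.2)
      ↑(Zd.bridges (d + 1) M ×ˢ Zd.bridges (d + 1) N) := by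
    rintro ⟨η, τ⟩ hp ⟨η', τ'⟩ hp' h
    simp only [Finset.mem_coe, Finset.mem_product] at hp hp'
    obtain ⟨h1, h2⟩ := Zd.concatWalk_injective_pieces (Zd.mem_bridges.1 hp.1).1
      (Zd.mem_bridges.1 hp.2).1 (Zd.mem_bridges.1 hp'.1).1 (Zd.mem_bridges.1 hp'.2).1 h
    subst h1 h2
    rfl
  have hsub : (Zd.bridges (d + 1) M ×ˢ Zd.bridges (d + 1) N).image
      (fun p : (ℕ → Site (d + 1)) × (ℕ → Site (d + 1)) => Zd.concatWalk M p.1 p.2) ⊆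
      Zd.bridges (d + 1) (M + N) := by
    intro ω hω
    obtain ⟨⟨η, τ⟩, hp, rfl⟩ := Finset.mem_image.1 hω
    obtain ⟨hη, hτ⟩ := Finset.mem_product.1 hp
    have hτ' : τ ∈ Zd.bridges (d + 1) (M + N - M) := hN ▸ hτ
    exact Zd.concatWalk_mem_bridges (Nat.le_add_right M N) hη hτ'
  calc ∑ p ∈ Zd.bridges (d + 1) M ×ˢ Zd.bridges (d + 1) N, y ^ (p.1 M 0).toNat * y ^ (p.2 N 0).toNat
      = ∑ p ∈ Zd.bridges (d + 1) M ×ˢ Zd.bridges (d + 1) N,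
          y ^ (Zd.concatWalk M p.1 p.2 (M + N) 0).toNat := by
        refine Finset.sum_congr rfl fun p hp => ?_
        obtain ⟨hη, hτ⟩ := Finset.mem_product.1 hp
        exact (pow_span_concatWalk y hη hτ).symm
    _ = ∑ ω ∈ (Zd.bridges (d + 1) M ×ˢ Zd.bridges (d + 1) N).image
          (fun p : (ℕ → Site (d + 1)) × (ℕ → Site (d + 1)) => Zd.concatWalk M p.1 p.2),
          y ^ (ω (M + N) 0).toNat := by
        rw [Finset.sum_image hinj]
    _ ≤ ∑ ω ∈ Zd.bridges (d + 1) (M + N), y ^ (ω (M + N) 0).toNat :=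
        Finset.sum_le_sum_of_subset_of_nonneg hsub fun ω _ _ => pow_nonneg hy _

/-- `Z^B_N(y) > 0` for `y > 0` (there is a bridge of every length: `Zd.one_le_bridgeCount`).
[cite: Beaton2015, §2] -/
theorem pulledBridgeZ_pos (d N : ℕ) {y : ℝ} (hy : 0 < y) : 0 < pulledBridgeZ (d + 1) N y := by
  rw [pulledBridgeZ_eq_sum_bridges]
  have h1 : 1 ≤ Zd.bridgeCount (d + 1) N := Zd.one_le_bridgeCount N
  have hne : (Zd.bridges (d + 1) N).Nonempty := by
    rw [← Finset.card_pos]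
    exact h1
  exact Finset.sum_pos (fun ω _ => pow_pos hy _) hne

/-- (R30.3a) one span class is a lower bound: `#brSpan(n,A)·y^A ≤ Z^B_n(y)` (`y ≥ 0`).
[cite: Beaton2015, §2] -/
theorem card_brSpan_mul_pow_le_pulledBridgeZ (d n A : ℕ) {y : ℝ} (hy : 0 ≤ y) :
    ((Zd.brSpan (d + 1) n (A : ℤ)).card : ℝ) * y ^ A ≤ pulledBridgeZ (d + 1) n y := by
  classical
  rcases le_or_gt A n with hAn | hAn
  · rw [pulledBridgeZ]
    exact Finset.single_le_sum (f := fun A : ℕ => ((Zd.brSpan (d + 1) n (A : ℤ)).card : ℝ) * y ^ A)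
      (fun A _ => by positivity) (Finset.mem_range.2 (Nat.lt_succ_of_le hAn))
  · have hem : Zd.brSpan (d + 1) n (A : ℤ) = ∅ := by
      rw [Finset.eq_empty_iff_forall_notMem]
      intro ω hω
      obtain ⟨hωb, hωA⟩ := Zd.mem_brSpan.1 hω
      have := span_le_of_mem_bridges hωb
      rw [hωA] at this
      exact absurd this (by omega)
    rw [hem, Finset.card_empty, Nat.cast_zero, zero_mul]
    exact (pulledBridgeZ_pos' d n hy)
where
  /-- `Z^B_n(y) ≥ 0` -/
  pulledBridgeZ_pos' (d n : ℕ) {y : ℝ} (hy : 0 ≤ y) : 0 ≤ pulledBridgeZ (d + 1) n y :=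
    Finset.sum_nonneg fun A _ => by positivity

/-- (R30.3b) the span-`kA` class of the length-generating function is dominated by the pulled sums:
`y^{B} · V_L(z;B) ≤ Σ_{n ≤ L} Z^B_n(y) zⁿ` (`y, z ≥ 0`; used with `B = kA`, `L = kM` after `Zd.brGF_pow_le`).
[cite: Beaton2015, §2 (derived)] -/
theorem pow_mul_brGF_le_sum_pulledBridgeZ (d L B : ℕ) {y z : ℝ} (hy : 0 ≤ y) (hz : 0 ≤ z) :
    y ^ B * Zd.brGF (d + 1) L z (B : ℤ) ≤
      ∑ n ∈ Finset.range (L + 1), pulledBridgeZ (d + 1) n y * z ^ n := by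
  rw [Zd.brGF, Finset.mul_sum]
  refine Finset.sum_le_sum fun n _ => ?_
  have h := card_brSpan_mul_pow_le_pulledBridgeZ d n B hy
  have hz' : 0 ≤ z ^ n := pow_nonneg hz n
  calc y ^ B * (((Zd.brSpan (d + 1) n (B : ℤ)).card : ℝ) * z ^ n)
      = (((Zd.brSpan (d + 1) n (B : ℤ)).card : ℝ) * y ^ B) * z ^ n := by ring
    _ ≤ pulledBridgeZ (d + 1) n y * z ^ n := mul_le_mul_of_nonneg_right h hz'

/-- (R30.3d) from ONE good length to ALL lengths (supermultiplicativity + positivity):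
if `Z^B_{n₁}(y) z^{n₁} ≥ 1` for some `n₁ ≥ 1` (`y > 0`, `z > 0`) then `Z^B_N(y) ≥ C z^{-N}` for all `N`.
[cite: Beaton2015, Theorem 1 (proof idea: supermultiplicativity; quantitative form derived)] -/
theorem pulledBridgeZ_geometric_of_one (d n₁ : ℕ) {y z : ℝ} (hy : 0 < y) (hz : 0 < z) (hn₁ : 1 ≤ n₁)
    (h : 1 ≤ pulledBridgeZ (d + 1) n₁ y * z ^ n₁) :
    ∃ C : ℝ, 0 < C ∧ ∀ N : ℕ, C * (1 / z) ^ N ≤ pulledBridgeZ (d + 1) N y := by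
  -- powers: Z_{j n₁} z^{j n₁} ≥ 1
  have hpow : ∀ j : ℕ, 1 ≤ pulledBridgeZ (d + 1) (j * n₁) y * z ^ (j * n₁) := by
    intro j
    induction j with
    | zero =>
      simp only [zero_mul, pow_zero, mul_one]
      rw [pulledBridgeZ, Finset.sum_range_one, pow_zero, mul_one]
      have hsub : Zd.bridges (d + 1) 0 ⊆ Zd.brSpan (d + 1) 0 ((0 : ℕ) : ℤ) := fun ω hω =>
        Zd.mem_brSpan.2 ⟨hω, by have h00 := (Zd.mem_saws.1 (Zd.mem_bridges.1 hω).1).1; simp [h00]⟩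
      have h1 : 1 ≤ (Zd.bridges (d + 1) 0).card := Zd.one_le_bridgeCount 0
      have h2 : (Zd.bridges (d + 1) 0).card ≤ (Zd.brSpan (d + 1) 0 ((0 : ℕ) : ℤ)).card :=
        Finset.card_le_card hsub
      exact_mod_cast h1.trans h2
    | succ j ih =>
      have hs := pulledBridgeZ_mul_le d (j * n₁) n₁ hy.le
      have h0 : 0 ≤ pulledBridgeZ (d + 1) (j * n₁) y * z ^ (j * n₁) := le_trans zero_le_one ih
      calc (1 : ℝ) ≤ (pulledBridgeZ (d + 1) (j * n₁) y * z ^ (j * n₁)) *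
            (pulledBridgeZ (d + 1) n₁ y * z ^ n₁) := by nlinarith
        _ = pulledBridgeZ (d + 1) (j * n₁) y * pulledBridgeZ (d + 1) n₁ y * z ^ (j * n₁ + n₁) := by
            rw [pow_add]; ring
        _ ≤ pulledBridgeZ (d + 1) (j * n₁ + n₁) y * z ^ (j * n₁ + n₁) :=
            mul_le_mul_of_nonneg_right hs (pow_nonneg hz.le _)
        _ = pulledBridgeZ (d + 1) ((j + 1) * n₁) y * z ^ ((j + 1) * n₁) := by rw [Nat.succ_mul]
  -- remainders: m = min_{r < n₁} Z_r > 0, and z^r ≥ min(1,z)^{n₁}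
  obtain ⟨m, hm0, hm⟩ : ∃ m : ℝ, 0 < m ∧ ∀ r < n₁, m ≤ pulledBridgeZ (d + 1) r y := by
    refine ⟨(Finset.range n₁).inf' ⟨0, by simp; omega⟩ (fun r => pulledBridgeZ (d + 1) r y), ?_,
      fun r hr => Finset.inf'_le _ (Finset.mem_range.2 hr)⟩
    obtain ⟨r, -, hreq⟩ := Finset.exists_mem_eq_inf' (s := Finset.range n₁) ⟨0, by simp; omega⟩
      (fun r => pulledBridgeZ (d + 1) r y)
    rw [hreq]
    exact pulledBridgeZ_pos d r hy
  set w : ℝ := min 1 z with hw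
  have hw0 : 0 < w := lt_min zero_lt_one hz
  have hwz : ∀ r < n₁, w ^ n₁ ≤ z ^ r := by
    intro r hr
    calc w ^ n₁ ≤ w ^ r := pow_le_pow_of_le_one hw0.le (min_le_left _ _) hr.le
      _ ≤ z ^ r := pow_le_pow_left₀ hw0.le (min_le_right _ _) r
  refine ⟨m * w ^ n₁, by positivity, fun N => ?_⟩
  -- N = q n₁ + r
  set q := N / n₁ with hq
  set r := N % n₁ with hr
  have hN : N = q * n₁ + r := by rw [hq, hr, Nat.mul_comm]; exact (Nat.div_add_mod N n₁).symm
  have hrlt : r < n₁ := Nat.mod_lt N (by omega)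
  have hzq : 1 ≤ pulledBridgeZ (d + 1) (q * n₁) y * z ^ (q * n₁) := hpow q
  have hsup := pulledBridgeZ_mul_le d (q * n₁) r hy.le
  rw [← hN] at hsup
  have hZr := hm r hrlt
  have hzr := hwz r hrlt
  -- C (1/z)^N ≤ Z_{q n₁} Z_r ≤ Z_N
  have hzN : (1 / z) ^ N = 1 / (z ^ (q * n₁) * z ^ r) := by
    rw [← pow_add, ← hN, one_div, one_div, inv_pow]
  rw [hzN]
  have hzpos : 0 < z ^ (q * n₁) * z ^ r := by positivity
  rw [mul_one_div, div_le_iff₀ hzpos]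
  have hZq0 : 0 ≤ pulledBridgeZ (d + 1) (q * n₁) y := (pulledBridgeZ_pos d _ hy).le
  calc m * w ^ n₁ ≤ pulledBridgeZ (d + 1) r y * z ^ r := by
        have := mul_le_mul hZr hzr (pow_nonneg hw0.le _) (pulledBridgeZ_pos d r hy).le
        linarith
    _ = 1 * (pulledBridgeZ (d + 1) r y * z ^ r) := (one_mul _).symm
    _ ≤ (pulledBridgeZ (d + 1) (q * n₁) y * z ^ (q * n₁)) * (pulledBridgeZ (d + 1) r y * z ^ r) :=
        mul_le_mul_of_nonneg_right hzq (mul_nonneg (pulledBridgeZ_pos d r hy).le (pow_nonneg hz.le r))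
    _ = (pulledBridgeZ (d + 1) (q * n₁) y * pulledBridgeZ (d + 1) r y) * (z ^ (q * n₁) * z ^ r) := by ring
    _ ≤ pulledBridgeZ (d + 1) N y * (z ^ (q * n₁) * z ^ r) :=
        mul_le_mul_of_nonneg_right hsup hzpos.le

/-- `Z^B_0(y) = 1` (the zero-step bridge).
[cite: Beaton2015, §2] -/
theorem pulledBridgeZ_zero (d : ℕ) (y : ℝ) : pulledBridgeZ (d + 1) 0 y = 1 := by
  classical
  rw [pulledBridgeZ, Finset.sum_range_one, pow_zero, mul_one]
  have hsub : Zd.bridges (d + 1) 0 ⊆ Zd.brSpan (d + 1) 0 ((0 : ℕ) : ℤ) := fun ω hω =>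
    Zd.mem_brSpan.2 ⟨hω, by have h00 := (Zd.mem_saws.1 (Zd.mem_bridges.1 hω).1).1; simp [h00]⟩
  have hsup : Zd.brSpan (d + 1) 0 ((0 : ℕ) : ℤ) ⊆ Zd.bridges (d + 1) 0 := fun ω hω =>
    (Zd.mem_brSpan.1 hω).1
  have heq : Zd.brSpan (d + 1) 0 ((0 : ℕ) : ℤ) = Zd.bridges (d + 1) 0 := Finset.Subset.antisymm hsup hsub
  rw [heq]
  have h1 : 1 ≤ (Zd.bridges (d + 1) 0).card := Zd.one_le_bridgeCount 0
  have h2 : (Zd.bridges (d + 1) 0).card ≤ Zd.count (d + 1) 0 := Zd.bridgeCount_le_count 0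
  rw [Zd.count_zero] at h2
  have : (Zd.bridges (d + 1) 0).card = 1 := le_antisymm h2 h1
  exact_mod_cast this

/-- (R30.3c') pigeonhole over `0 ≤ n ≤ L` (the `n = 0` term is `Z^B_0 = 1`, so the witness has `n ≥ 1`).
[folklore] -/
private theorem exists_one_lt_pulledBridgeZ_mul_pow (d L : ℕ) {y z : ℝ}
    (h : (L : ℝ) + 1 < ∑ n ∈ Finset.range (L + 1), pulledBridgeZ (d + 1) n y * z ^ n) :
    ∃ n : ℕ, 1 ≤ n ∧ n ≤ L ∧ 1 < pulledBridgeZ (d + 1) n y * z ^ n := by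
  have hL : ∑ n ∈ Finset.range (L + 1), (1 : ℝ) = L + 1 := by simp
  rw [← hL] at h
  obtain ⟨n, hn, hlt⟩ := Finset.exists_lt_of_sum_lt h
  have hnL : n ≤ L := Nat.lt_succ_iff.1 (Finset.mem_range.1 hn)
  rcases Nat.eq_zero_or_pos n with rfl | hpos
  · rw [pulledBridgeZ_zero, pow_zero, mul_one] at hlt
    exact absurd hlt (lt_irrefl _)
  · exact ⟨n, hpos, hnL, hlt⟩

/-- (R30.1') existence of the truncation level: if `z` is ADMISSIBLE
(`zμ ≥ 1`, or `zμ < 1` and `E(1 - zμ) < z`, i.e. `E < z/(1-zμ)`), then some finite `M` has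
`E < z Σ_{n ≤ M} (zμ)ⁿ`.
[folklore] -/
private theorem exists_truncation_level (d : ℕ) {z E : ℝ} (hz : 0 < z) (_hE : 0 < E)
    (hadm : 1 ≤ z * Zd.connectiveConstant (d + 1) ∨
      (z * Zd.connectiveConstant (d + 1) < 1 ∧ E * (1 - z * Zd.connectiveConstant (d + 1)) < z)) :
    ∃ M : ℕ, E < z * ∑ n ∈ Finset.range (M + 1), (z * Zd.connectiveConstant (d + 1)) ^ n := by
  set μ := Zd.connectiveConstant (d + 1) with hμ
  rcases hadm with h1 | ⟨h1, h2⟩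
  · obtain ⟨M, hM⟩ := exists_nat_gt (E / z)
    refine ⟨M, ?_⟩
    have hS : ((M : ℝ) + 1) ≤ ∑ n ∈ Finset.range (M + 1), (z * μ) ^ n := by
      have := Finset.card_nsmul_le_sum (Finset.range (M + 1)) (fun n => (z * μ) ^ n) 1
        (fun n _ => one_le_pow₀ h1)
      simpa using this
    have hEz : E < z * ((M : ℝ) + 1) := by
      rw [div_lt_iff₀ hz] at hM
      nlinarith
    exact lt_of_lt_of_le hEz (mul_le_mul_of_nonneg_left hS hz.le)
  · have hzμ0 : 0 ≤ z * μ := mul_nonneg hz.le (Zd.connectiveConstant_nonneg (d + 1))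
    have hδ : 0 < 1 - E * (1 - z * μ) / z := by
      rw [sub_pos, div_lt_one hz]; exact h2
    obtain ⟨M, hM⟩ := exists_pow_lt_of_lt_one hδ h1
    refine ⟨M, ?_⟩
    have h1' : 0 < 1 - z * μ := sub_pos.2 h1
    have hne : z * μ - 1 ≠ 0 := by linarith
    have hgeom : ∑ n ∈ Finset.range (M + 1), (z * μ) ^ n = (1 - (z * μ) ^ (M + 1)) / (1 - z * μ) := by
      rw [geom_sum_eq (ne_of_lt h1)]
      rw [div_eq_div_iff hne h1'.ne']
      ring
    have hpowle : (z * μ) ^ (M + 1) ≤ (z * μ) ^ M := pow_le_pow_of_le_one hzμ0 h1.le (Nat.le_succ M)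
    have key : E * (1 - z * μ) < z * (1 - (z * μ) ^ (M + 1)) := by
      have h3 : E * (1 - z * μ) / z < 1 - (z * μ) ^ (M + 1) := by linarith
      rw [div_lt_iff₀ hz] at h3
      linarith
    rw [hgeom, mul_div_assoc', lt_div_iff₀ h1']
    exact key

/-- (R30.3) CORE: for an admissible `z` (see `exists_truncation_level`) and `y > 1`,
`Z^B_N(y) ≥ C · z^{-N}` for all `N`.  Chain: `exists_truncation_level` → `half_log_geom_le_bridgeGFpos` → `exists_span_lt_brGF`
(with `ε = log y`) → `Zd.brGF_pow_le` + `pow_mul_brGF_le_sum_pulledBridgeZ` → `exists_one_lt_pulledBridgeZ_mul_pow` → `pulledBridgeZ_geometric_of_one`.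
[cite: Beaton2015, Theorem 1 (quantitative form, derived)] -/
theorem pulledBridgeZ_geometric_of_admissible (d : ℕ) {y z : ℝ} (hy : 1 < y) (hz : 0 < z)
    (hadm : 1 ≤ z * Zd.connectiveConstant (d + 1) ∨
      (z * Zd.connectiveConstant (d + 1) < 1 ∧
        Real.exp (2 / (y - 1)) * (1 - z * Zd.connectiveConstant (d + 1)) < z)) :
    ∃ C : ℝ, 0 < C ∧ ∀ N : ℕ, C * (1 / z) ^ N ≤ pulledBridgeZ (d + 1) N y := by
  have hy0 : 0 < y := by linarith
  set E := Real.exp (2 / (y - 1)) with hE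
  have hE0 : 0 < E := Real.exp_pos _
  obtain ⟨M, hM⟩ := exists_truncation_level d hz hE0 hadm
  -- B⁺_{M+1}(z) > 1/(y-1)
  have hB := half_log_geom_le_bridgeGFpos d M hz
  have hlog : 2 / (y - 1) <
      Real.log (z * ∑ n ∈ Finset.range (M + 1), (z * Zd.connectiveConstant (d + 1)) ^ n) := by
    have := Real.log_lt_log hE0 hM
    rwa [hE, Real.log_exp] at this
  have hB' : 1 / (Real.exp (Real.log y) - 1) < Zd.bridgeGFpos (d + 1) (M + 1) z := by
    rw [Real.exp_log hy0]
    have : 1 / (y - 1) = (2 / (y - 1)) / 2 := by ring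
    rw [this]
    linarith
  obtain ⟨A, hA1, -, hA⟩ := exists_span_lt_brGF d (M + 1) hz.le (Real.log_pos hy) hB'
  -- q := y^A · V_{M+1}(z;A) > 1
  set V := Zd.brGF (d + 1) (M + 1) z (A : ℤ) with hV
  have hV0 : 0 < V := lt_trans (Real.exp_pos _) hA
  have hyA : Real.exp (-(Real.log y * (A : ℝ))) = (y ^ A)⁻¹ := by
    rw [mul_comm, Real.exp_neg, Real.exp_nat_mul, Real.exp_log hy0]
  have hyA0 : 0 < y ^ A := pow_pos hy0 A
  rw [hyA] at hA
  have hq : 1 < y ^ A * V := by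
    have := mul_lt_mul_of_pos_left hA hyA0
    rwa [mul_inv_cancel₀ hyA0.ne'] at this
  set q := y ^ A * V with hqdef
  -- k with q^k > k(M+1) + 1
  obtain ⟨k, hk⟩ : ∃ k : ℕ, ((k * (M + 1) : ℕ) : ℝ) + 1 < q ^ k := by
    have ht := tendsto_pow_const_div_const_pow_of_one_lt 1 hq
    have hε : (0 : ℝ) < 1 / (2 * ((M : ℝ) + 2)) := by positivity
    obtain ⟨k, hk, hk1⟩ := ((ht.eventually (gt_mem_nhds hε)).and (Filter.eventually_ge_atTop 1)).exists
    refine ⟨k, ?_⟩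
    have hqk : 0 < q ^ k := pow_pos (by linarith) k
    rw [pow_one, div_lt_div_iff₀ hqk (by positivity), one_mul] at hk
    have hk1' : (1 : ℝ) ≤ k := by exact_mod_cast hk1
    push_cast
    nlinarith
  -- the big sum dominates q^k
  set L := k * (M + 1) with hL
  have hpow := Zd.brGF_pow_le (d := d + 1) (M + 1) hz.le (A : ℤ) k
  have hsum := pow_mul_brGF_le_sum_pulledBridgeZ d L (k * A) hy0.le hz.le
  have hcast : ((k * A : ℕ) : ℤ) = (k : ℤ) * (A : ℤ) := by push_cast; ring
  rw [hcast] at hsum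
  have hqk : q ^ k ≤ ∑ n ∈ Finset.range (L + 1), pulledBridgeZ (d + 1) n y * z ^ n := by
    calc q ^ k = y ^ (k * A) * V ^ k := by rw [hqdef, mul_pow, ← pow_mul, mul_comm A k]
      _ ≤ y ^ (k * A) * Zd.brGF (d + 1) (k * (M + 1)) z ((k : ℤ) * (A : ℤ)) :=
          mul_le_mul_of_nonneg_left hpow (pow_nonneg hy0.le _)
      _ ≤ _ := hsum
  obtain ⟨n₁, hn₁, -, hlt⟩ := exists_one_lt_pulledBridgeZ_mul_pow d L (lt_of_lt_of_le hk hqk)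
  exact pulledBridgeZ_geometric_of_one d n₁ hy0 hz hn₁ hlt.le

/-- (R30.4) **EXPLICIT BALLISTIC GAIN, every `d ≥ 1`, every pull `y > 1`:**
`Z^B_N(y) ≥ C ρ^N` for every `ρ < μ_d + e^{-2/(y-1)}`; in particular the free energy of pulled
bridges satisfies `λ_B(y) ≥ log(μ + e^{-2/(y-1)}) > log μ` — strict ballisticity with an EXPLICIT gain,
from the tree's Kesten-divergence bound alone (no SLE, no pattern theorem, no numerics).
[cite: Beaton2015, Theorem 1 and its proof, eq. (8) (every d; quantitative form with explicit gain, derived)] -/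
theorem pulledBridgeZ_geometric_lower (d : ℕ) {y ρ : ℝ} (hy : 1 < y) (hρ0 : 0 < ρ)
    (hρ : ρ < Zd.connectiveConstant (d + 1) + Real.exp (-(2 / (y - 1)))) :
    ∃ C : ℝ, 0 < C ∧ ∀ N : ℕ, C * ρ ^ N ≤ pulledBridgeZ (d + 1) N y := by
  set μ := Zd.connectiveConstant (d + 1) with hμ
  set E := Real.exp (2 / (y - 1)) with hE
  have hE0 : 0 < E := Real.exp_pos _
  have hEinv : Real.exp (-(2 / (y - 1))) = E⁻¹ := by rw [Real.exp_neg]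
  rw [hEinv] at hρ
  have hμ0 : 0 ≤ μ := Zd.connectiveConstant_nonneg (d + 1)
  -- ρ < ρ' < μ + 1/E, z := 1/ρ'
  set ρ' := (ρ + (μ + E⁻¹)) / 2 with hρ'
  have h1 : ρ < ρ' := by rw [hρ']; linarith
  have h2 : ρ' < μ + E⁻¹ := by rw [hρ']; linarith
  have hρ'0 : 0 < ρ' := lt_trans hρ0 h1
  set z := ρ'⁻¹ with hz
  have hz0 : 0 < z := inv_pos.2 hρ'0
  have hzρ : z * ρ' = 1 := inv_mul_cancel₀ hρ'0.ne'
  -- admissibility of z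
  have hadm : 1 ≤ z * μ ∨ (z * μ < 1 ∧ E * (1 - z * μ) < z) := by
    rcases le_or_gt 1 (z * μ) with hle | hlt
    · exact Or.inl hle
    · refine Or.inr ⟨hlt, ?_⟩
      -- E(1 - zμ) < z  ⇔  E ρ' (1 - zμ) < 1  ⇔  E ρ' < 1 + Eμ  ⇔ ρ' < μ + 1/E
      have hEρ : E * ρ' < 1 + E * μ := by
        have := mul_lt_mul_of_pos_left h2 hE0
        rwa [mul_add, mul_inv_cancel₀ hE0.ne', add_comm] at this
      have : E * (1 - z * μ) * ρ' < z * ρ' := by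
        have hexp : E * (1 - z * μ) * ρ' = E * ρ' - E * μ * (z * ρ') := by ring
        rw [hexp, hzρ, mul_one]
        linarith
      exact lt_of_mul_lt_mul_right this hρ'0.le
  obtain ⟨C, hC, hall⟩ := pulledBridgeZ_geometric_of_admissible d hy hz0 hadm
  refine ⟨C, hC, fun N => le_trans ?_ (hall N)⟩
  have hz1 : 1 / z = ρ' := by rw [hz, one_div, inv_inv]
  rw [hz1]
  exact mul_le_mul_of_nonneg_left (pow_le_pow_left₀ hρ0.le h1.le N) hC.le

/-- (R30.5) transfer UPWARD: `Z^B_N(e^θ) ≤ Z^H_N(e^θ) ≤ Z_N(θ)` (bridges ⊆ half-space walks ⊆ SAWs;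
on half-space walks the endpoint level is `≥ 0`, so `y^{span}` is the drift weight `e^{θ x₁(ω_N)}`). Any `θ`.
[cite: Beaton2015, §2 (bridges ⊆ half-plane walks ⊆ SAWs)] -/
theorem pulledBridgeZ_le_pulledHalfSpaceZ_le_driftZ (d N : ℕ) (θ : ℝ) :
    pulledBridgeZ (d + 1) N (Real.exp θ) ≤ pulledHalfSpaceZ (d + 1) N (Real.exp θ) ∧
      pulledHalfSpaceZ (d + 1) N (Real.exp θ) ≤ driftZ (d + 1) N θ := by
  classical
  constructor
  · rw [pulledBridgeZ_eq_sum_bridges, pulledHalfSpaceZ]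
    exact Finset.sum_le_sum_of_subset_of_nonneg (Zd.bridges_subset_halfSpaceWalks N)
      (fun ω _ _ => by positivity)
  · rw [pulledHalfSpaceZ, driftZ]
    have hsub : Zd.halfSpaceWalks (d + 1) N ⊆ Zd.saws (d + 1) N := fun ω hω =>
      (Zd.mem_halfSpaceWalks.1 hω).1
    have hnn : ∀ ω ∈ Zd.halfSpaceWalks (d + 1) N, 0 ≤ ω N 0 := by
      intro ω hω
      have h00 : ω 0 0 = 0 := by
        have := (Zd.mem_saws.1 (Zd.mem_halfSpaceWalks.1 hω).1).1
        simp [this]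
      rcases Nat.eq_zero_or_pos N with rfl | hN
      · rw [h00]
      · have := (Zd.mem_halfSpaceWalks.1 hω).2 N hN le_rfl
        omega
    calc ∑ ω ∈ Zd.halfSpaceWalks (d + 1) N, Real.exp θ ^ (ω N 0).toNat
        = ∑ ω ∈ Zd.halfSpaceWalks (d + 1) N, Real.exp (θ * ((ω N 0 : ℤ) : ℝ)) := by
          refine Finset.sum_congr rfl fun ω hω => ?_
          have h0 := hnn ω hω
          have hcast : (((ω N 0).toNat : ℕ) : ℝ) = ((ω N 0 : ℤ) : ℝ) := by
            have : (((ω N 0).toNat : ℕ) : ℤ) = ω N 0 := Int.toNat_of_nonneg h0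
            exact_mod_cast this
          rw [← Real.exp_nat_mul, hcast, mul_comm]
      _ ≤ ∑ ω ∈ Zd.saws (d + 1) N, Real.exp (θ * ((ω N 0 : ℤ) : ℝ)) :=
          Finset.sum_le_sum_of_subset_of_nonneg hsub (fun _ _ _ => (Real.exp_pos _).le)

/-- (R30.6) the explicit gain in Ioffe–Velenik's language: for the drifted SAW partition function
`Z_N(θ) = Σ_{ω ∈ SAW_N} e^{θ x₁(ω_N)}` (`θ > 0`) and for half-space pulled walks,
`Z_N(θ) ≥ Z^H_N(e^θ) ≥ C ρᴺ` for every `ρ < μ_d + exp(-2/(e^θ - 1))`.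
[cite: IoffeVelenik2008, §1.4 (1) (ballistic phase, qualitative); Beaton2015, Theorem 1 (quantitative form with explicit gain, derived)] -/
theorem driftZ_geometric_lower (d : ℕ) {θ ρ : ℝ} (hθ : 0 < θ) (hρ0 : 0 < ρ)
    (hρ : ρ < Zd.connectiveConstant (d + 1) + Real.exp (-(2 / (Real.exp θ - 1)))) :
    ∃ C : ℝ, 0 < C ∧ ∀ N : ℕ,
      C * ρ ^ N ≤ pulledHalfSpaceZ (d + 1) N (Real.exp θ) ∧ C * ρ ^ N ≤ driftZ (d + 1) N θ := by
  have hy : 1 < Real.exp θ := by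
    have h := Real.exp_lt_exp.2 hθ
    rwa [Real.exp_zero] at h
  obtain ⟨C, hC, h⟩ := pulledBridgeZ_geometric_lower d hy hρ0 hρ
  refine ⟨C, hC, fun N => ?_⟩
  obtain ⟨h1, h2⟩ := pulledBridgeZ_le_pulledHalfSpaceZ_le_driftZ d N θ
  exact ⟨(h N).trans h1, ((h N).trans h1).trans h2⟩

end Literature.Probability.RandomPlanarGeometry.SAW.Zd

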